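import Mathlib
import Summits.Ventures.Crystal3D.Theorems.StickyWulffConstantTextureLiminfTentCost
import HarnessLib

/-!
# The tent certificate for fcc grains — the mass clause (eng g8)

Route `StickyWulffConstant` (`Summits/Ventures/Crystal3D`, cell `crystal3d-full`), support toward the crux
`TextureLiminf` (stmt-Ventures-19483), FREE half (tent certificate, TexShadow v6.1), clause
"`G ⊇` every point all of whose sites within `√2` are occupied":
* `exists_mem_closedChamber_labelOf` — every point of space lies in the closed chamber of some cell
  (an up- or down-tetrahedron or an octahedron corner): floor labels of nearby off-plane points range over a finite
  set, so one of their cells accumulates at the point; classification of nonempty chambers;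
* `tent_eq_one_of_forall_dist_le` — if every site within `√2` of `y` is in `X` then `f_X(y) = 1`;
* `setOf_forall_dist_le_subset_superlevel` — hence that set lies in `{f_X > t}` for every `t < 1`.
WHAT THIS IS NOT: the certificate; F-C1 not moved.
-/

noncomputable section

namespace Summit.Ventures.Crystal3D.TentCertificate

open Finset Summit.Ventures.Crystal3D MeasureTheory
open Literature.Geometry.DiscreteGeometry (intVec intVec_apply)
open scoped RealInnerProductSpace

/-- Coordinates are `1`-Lipschitz. -/
theorem abs_apply_sub_le_dist (z y : EuclideanSpace ℝ (Fin 3)) (i : Fin 3) : |z i - y i| ≤ dist z y := by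
  rw [EuclideanSpace.dist_eq]
  have h : |z i - y i| = Real.sqrt ((z i - y i) ^ 2) := (Real.sqrt_sq_eq_abs _).symm
  rw [h]
  apply Real.sqrt_le_sqrt
  simp only [Real.dist_eq, sq_abs]
  rw [Fin.sum_univ_three]
  fin_cases i <;> simp <;> nlinarith [sq_nonneg (z 0 - y 0), sq_nonneg (z 1 - y 1), sq_nonneg (z 2 - y 2)]

/-- The `(111)` functional of a difference is at most `3 ×` the distance (crude). -/
theorem abs_inner_normal4_le (j : Fin 4) (z y : EuclideanSpace ℝ (Fin 3)) :
    |⟪intVec (normal4 j), z⟫ - ⟪intVec (normal4 j), y⟫| ≤ 3 * dist z y := by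
  rw [← inner_sub_right, inner_intVec_left]
  have h0 := abs_apply_sub_le_dist z y 0
  have h1 := abs_apply_sub_le_dist z y 1
  have h2 := abs_apply_sub_le_dist z y 2
  have hn : ∀ i : Fin 3, |(normal4 j i : ℝ)| = 1 := by
    intro i; fin_cases j <;> fin_cases i <;> simp [normal4]
  simp only [PiLp.sub_apply]
  calc |(normal4 j 0 : ℝ) * (z 0 - y 0) + (normal4 j 1 : ℝ) * (z 1 - y 1) + (normal4 j 2 : ℝ) * (z 2 - y 2)|
      ≤ |(normal4 j 0 : ℝ) * (z 0 - y 0)| + |(normal4 j 1 : ℝ) * (z 1 - y 1)| +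
          |(normal4 j 2 : ℝ) * (z 2 - y 2)| := abs_add_three _ _ _
    _ ≤ 3 * dist z y := by rw [abs_mul, abs_mul, abs_mul, hn, hn, hn]; linarith

/-- Floors of nearby reals are nearby. -/
theorem floor_mem_Icc_of_abs_sub_lt {a b : ℝ} (h : |a - b| < 2) : ⌊a⌋ ∈ Set.Icc (⌊b⌋ - 2) (⌊b⌋ + 2) := by
  rw [abs_lt] at h
  have hb1 := Int.floor_le b; have hb2 := Int.lt_floor_add_one b
  have ha1 := Int.floor_le a; have ha2 := Int.lt_floor_add_one a
  constructor
  · have : ((⌊b⌋ : ℤ) : ℝ) - 2 < (⌊a⌋ : ℝ) + 1 := by linarith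
    have : ⌊b⌋ - 2 < ⌊a⌋ + 1 := by exact_mod_cast this
    omega
  · have : ((⌊a⌋ : ℤ) : ℝ) < (⌊b⌋ : ℝ) + 3 := by linarith
    have : ⌊a⌋ < ⌊b⌋ + 3 := by exact_mod_cast this
    omega

/-- **Every point lies in the closed chamber of some cell.** -/
theorem exists_mem_closedChamber_labelOf (y : EuclideanSpace ℝ (Fin 3)) :
    ∃ (p : Site) (κ : Bool ⊕ (Fin 3 → Bool)), y ∈ closedChamber (labelOf p κ).1 (labelOf p κ).2 := by
  -- the finite box of labels of floor chambers of points within `1/2` of `y`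
  set ky : Fin 3 → ℤ := fun i => ⌊Real.sqrt 2 * y i⌋ with hky
  set my : Fin 4 → ℤ := fun j => ⌊⟪intVec (normal4 j), Real.sqrt 2 • y⟫ / 2⌋ with hmy
  set T : Set ((Fin 3 → ℤ) × (Fin 4 → ℤ)) :=
    (Set.univ.pi fun i => Set.Icc (ky i - 2) (ky i + 2)) ×ˢ (Set.univ.pi fun j => Set.Icc (my j - 2) (my j + 2))
    with hT
  have hTf : T.Finite :=
    (Set.Finite.pi fun i => Set.finite_Icc _ _).prod (Set.Finite.pi fun j => Set.finite_Icc _ _)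
  have hs : (0 : ℝ) < Real.sqrt 2 := by positivity
  have hs2 : Real.sqrt 2 < 2 := by
    rw [show (2 : ℝ) = Real.sqrt 4 by rw [show (4:ℝ) = 2 ^ 2 by norm_num, Real.sqrt_sq (by norm_num)]]
    exact Real.sqrt_lt_sqrt (by norm_num) (by norm_num)
  -- `y` is in the closure of the union of those chambers
  have hcl : y ∈ closure (⋃ ℓ ∈ T, cellOf ℓ.1 ℓ.2) := by
    rw [Metric.mem_closure_iff]
    intro ε hε
    obtain ⟨z, hzd, hz1, hz2⟩ := exists_near_off_planes y (lt_min hε (by norm_num : (0:ℝ) < 1 / 2))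
    have hzy : dist z y < 1 / 2 := lt_of_lt_of_le hzd (min_le_right _ _)
    have hmemT : ((fun i : Fin 3 => ⌊Real.sqrt 2 * z i⌋),
        (fun j : Fin 4 => ⌊⟪intVec (normal4 j), Real.sqrt 2 • z⟫ / 2⌋)) ∈ T := by
      refine Set.mk_mem_prod (Set.mem_univ_pi.2 fun i => ?_) (Set.mem_univ_pi.2 fun j => ?_)
      · apply floor_mem_Icc_of_abs_sub_lt
        rw [← mul_sub, abs_mul, abs_of_pos hs]
        nlinarith [abs_apply_sub_le_dist z y i, abs_nonneg (z i - y i)]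
      · apply floor_mem_Icc_of_abs_sub_lt
        have h := abs_inner_normal4_le j (Real.sqrt 2 • z) (Real.sqrt 2 • y)
        rw [dist_smul₀, Real.norm_eq_abs, abs_of_pos hs] at h
        rw [← sub_div, abs_div, abs_two]
        nlinarith [h]
    exact ⟨z, Set.mem_biUnion hmemT (mem_cellOf_floor hz1 hz2),
      by rw [dist_comm]; exact lt_of_lt_of_le hzd (min_le_left _ _)⟩
  rw [hTf.closure_biUnion] at hcl
  obtain ⟨ℓ, hℓT, hyℓ⟩ := Set.mem_iUnion₂.1 hcl
  -- that chamber is nonempty, hence a cell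
  have hne : (cellOf ℓ.1 ℓ.2).Nonempty := by
    by_contra h
    rw [Set.not_nonempty_iff_eq_empty] at h
    rw [h, closure_empty] at hyℓ
    exact hyℓ
  obtain ⟨x, hx⟩ := hne
  obtain ⟨p, hp⟩ := exists_label_of_mem_cellOf hx
  obtain ⟨κ, hκ⟩ := label_cases_labelOf hp
  refine ⟨p, κ, ?_⟩
  rw [← hκ]
  exact closure_cellOf_subset_closedChamber _ _ hyℓ

/-- The fully occupied octahedron pattern has centre value `1`. -/
theorem twoAlpha_all_true : twoAlpha (fun _ : Fin 6 => true) = 2 := by decide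

/-- **If every site within `√2` of `y` is occupied, the tent equals `1` at `y`.** -/
theorem tent_eq_one_of_forall_dist_le (X : Finset Site) {y : EuclideanSpace ℝ (Fin 3)}
    (hy : ∀ a : Site, dist (site a) y ≤ Real.sqrt 2 → a ∈ X) : tent X y = 1 := by
  obtain ⟨p, κ, hyc⟩ := exists_mem_closedChamber_labelOf y
  obtain ⟨g, b, hgb⟩ := exists_affine_tent X (labelOf p κ).1 (labelOf p κ).2
  rcases κ with bb | s
  · rcases Bool.eq_false_or_eq_true bb with hb | hb <;> subst hb
    · have hyc' : y ∈ closedChamber (labelUp p).1 (labelUp p).2 := by simpa [labelOf] using hyc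
      have hgb' : ∀ x ∈ closedChamber (labelUp p).1 (labelUp p).2, tent X x = ⟪g, x⟫ + b := by
        simpa [labelOf] using hgb
      have hv : ∀ j : Fin 4, ⟪g, site (p + tetUpV j)⟫ + b = 1 := by
        intro j
        have hmem := site_tetUpV_mem_closedChamber p j
        rw [← hgb' _ hmem, site_eq, tent_site, if_pos (hy _ ?_)]
        exact dist_le_sqrt2_of_mem_closedChamber hmem hyc'
      obtain ⟨t₀, t₁, t₂, -, -, -, -, hcombo⟩ := affine_eq_combo_labelUp p g b hyc'
      rw [← hgb' y hyc', hv, hv, hv, hv] at hcombo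
      rw [hcombo]; ring
    · have hyc' : y ∈ closedChamber (labelDn p).1 (labelDn p).2 := by simpa [labelOf] using hyc
      have hgb' : ∀ x ∈ closedChamber (labelDn p).1 (labelDn p).2, tent X x = ⟪g, x⟫ + b := by
        simpa [labelOf] using hgb
      have hv : ∀ j : Fin 4, ⟪g, site (p + tetDnV j)⟫ + b = 1 := by
        intro j
        have hmem := site_tetDnV_mem_closedChamber p j
        rw [← hgb' _ hmem, site_eq, tent_site, if_pos (hy _ ?_)]
        exact dist_le_sqrt2_of_mem_closedChamber hmem hyc'
      obtain ⟨t₀, t₁, t₂, -, -, -, -, hcombo⟩ := affine_eq_combo_labelDn p g b hyc'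
      rw [← hgb' y hyc', hv, hv, hv, hv] at hcombo
      rw [hcombo]; ring
  · have hyc' : y ∈ closedChamber (labelCorner p s).1 (labelCorner p s).2 := by simpa [labelOf] using hyc
    have hgb' : ∀ x ∈ closedChamber (labelCorner p s).1 (labelCorner p s).2, tent X x = ⟪g, x⟫ + b := by
      simpa [labelOf] using hgb
    have hall : ∀ i : Fin 6, p + octV i ∈ X := fun i => hy _ (dist_octV_le_sqrt2 p s hyc' i)
    have hpat : patO X p = fun _ => true := by funext i; simp [patO, hall i]
    have hv : ∀ a : Fin 3, ⟪g, site (p + octV (octIdx a (s a)))⟫ + b = 1 := by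
      intro a
      rw [← hgb' _ (site_octV_mem_closedChamber p s a), site_eq, tent_site, if_pos (hall _)]
    have hc : ⟪g, centre p⟫ + b = 1 := by
      rw [← hgb' _ (centre_mem_closedChamber p s), tent_centre, hpat, twoAlpha_all_true]; norm_num
    obtain ⟨t₀, t₁, t₂, -, -, -, -, hcombo⟩ := affine_eq_combo_labelCorner p s g b hyc'
    rw [← hgb' y hyc', hc, hv, hv, hv] at hcombo
    rw [hcombo]; ring

/-- **Mass clause**: for `t < 1`, every point all of whose sites within `√2` are occupied lies in `{f_X > t}`. -/
theorem setOf_forall_dist_le_subset_superlevel (X : Finset Site) {t : ℝ} (ht : t < 1) :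
    {y : EuclideanSpace ℝ (Fin 3) | ∀ a : Site, dist y (site a) ≤ Real.sqrt 2 → a ∈ X} ⊆
      {x | t < tent X x} := by
  intro y hy
  have h := tent_eq_one_of_forall_dist_le X (y := y) fun a ha => hy a (by rw [dist_comm]; exact ha)
  show t < tent X y
  rw [h]; exact ht

end Summit.Ventures.Crystal3D.TentCertificate

end
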